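import Literature.Analysis.FluidPDE.NSCriticalClosureTao
import Literature.Analysis.FluidPDE.NSLerayHopfSereginProofs
import Literature.Analysis.FluidPDE.MildSolutionProofs
import Literature.Analysis.FluidPDE.EnstrophySplitting
import HarnessLib

/-!
# Tao's smooth `H¹` class on closed slabs: restriction, translation, identification, gluing

Analysis/FluidPDE support file for the reduction of the named fact
`Literature.Analysis.FluidPDE.clay_solution_of_hasGlobalKatoSolution` (`NSKatoToClay.lean`) to Tao's
local existence theorem `Literature.Analysis.FluidPDE.tao2011_smooth_local_existence`
(`TaoH1LocalExistence.lean`; Tao 2013, Thm. 5.4 (ii)+(iv)), carried out in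
`NSKatoToClayProofs.lean` by the classical restart ("continuation") argument.

The predicate `IsTaoSolutionOn T ν u₀ u p` packages, field for field, the conclusion of
`tao2011_smooth_local_existence`: `(u, p)` is a classical solution of the unforced
Navier–Stokes system on the **closed** slab `[0, T] × ℝ³` with `u 0 = u₀`, all `L²` Sobolev
norms of `u`, of the one-sided time derivative `∂ₜu` (within `[0, T]`) and of `p` are bounded on
`[0, T]`, and `u ∈ C([0, T]; L²)` (Tao 2013, Thm. 5.4 (i), (ii), (iv): `u ∈ C⁰_t H¹_x`,
`∂ₜʲu, ∂ₜʲp ∈ L^∞_t H^k_x`). For this class the file proves the bookkeeping needed by a restart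
argument in which the solution has to be *constructed* (not merely shown to be regular):

* `IsTaoSolutionOn.mono`, `IsTaoSolutionOn.translate` — restriction to `[0, T']` and restart
  from a later time `a` (the closed-slab, one-sided-derivative variants of
  `IsClassicalNSSolutionOn.mono` / `.translate_Ico` of `ClassicalSolutionGlue.lean`);
* `exists_bound_velocity`, `exists_bound_pressure` (Sobolev imbedding `H² ⊂ C_B`, the proved
  `FunctionSpaces.exists_enorm_le_sobolev_two_two_dim_three`), `isLerayHopfOn` (the tree's
  `isLerayHopfOn_of_hasBoundedSobolevNormsOn`), `isMildNSSolutionOn` (classical bounded solutions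
  are mild: the proved `IsClassicalNSSolutionOn.isMildNSSolutionOn_holds`,
  Fabes–Jones–Rivière 1972, Thm. 2.1 (i)), `continuousInLpOn_three` (`L^∞ ∩ C_tL² ⊂ C_tL³`,
  the tree's `tendsto_eLpNorm_three_of_two`);
* `ae_eq_of_kato` — **identification with a Kato solution**: a Tao-class solution agrees a.e.,
  at every time of `[0, T)`, with any mild solution in `C([0, T); L³)` from the same datum (the
  proved uniqueness theorem of Furioli–Lemarié-Rieusset–Terraneo, `kato_unique_holds`);
* `eq_of_isTaoSolutionOn` — two Tao-class solutions from the same datum coincide on the common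
  slab (Prodi–Serrin weak–strong uniqueness, the proved `serrin_weak_strong_uniqueness_holds`, in
  the form `eq_restart_of_serrin` of `NSCriticalClosureTao.lean`);
* `gradient_pressure_eq_of_eqOn`, `pressure_eq` — the velocity determines `∇p`, also at the
  initial time (one-sided time derivatives within a common set of unique differentiability), and
  two `L²` pressures with the same gradient are *equal* (a constant in `L²(ℝ³)` vanishes), so that
  in this class no renormalisation of the pressure is needed when gluing;
* `IsTaoSolutionOn.glue` — **gluing**: a Tao-class solution on `[0, T₁]` from `u₀` and a
  Tao-class solution on `[0, T₂]` from the restart datum `u(a)`, `0 ≤ a < T₁ ≤ a + T₂`, glue to a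
  Tao-class solution on `[0, a + T₂]` from `u₀` (they agree on the overlap `[a, T₁)` by
  `eq_of_isTaoSolutionOn`; joint smoothness is local, the two pieces `[0, T₁)` and `(a, a + T₂]`
  being relatively open in `[0, a + T₂]`).

This is the restart step in the proof of Lemarié-Rieusset 2016, Thm. 7.2 (PDF p. 147: a mild
`H¹` solution on `[0, T]` and the local solution from `u(T)` on `[T, T + δ]`,
`δ = min(T₁ - T, 1, C_ν ‖u(T)‖_{H¹}^{-4})`, "give a mild solution on `(0, T + δ)`"), written for
classical solutions on closed slabs; cf. Robinson–Rodrigo–Sadowski 2016, proof of Lemma 6.11.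
No statement of the tree is modified. The only definition is the packaging structure
`IsTaoSolutionOn` (no new mathematical content: `isTaoSolutionOn_iff`).

## Mathlib / tree search

`lean search 'IsTaoSolution|TaoClass'`: nothing in the tree (a previous proposal of this file,
p14655, was withdrawn for two duplicated lemmas; the duplicates — `eLpNorm_natCast_pow_eq_lintegral`
(`LerayHopfProofs`), `lintegral_enorm_sq_eq_eLpNorm_two_sq` (`EnstrophySplitting`), the
`L^∞ ∩ L² ⊂ L³` lemmas `eLpNorm_three_pow_le` / `eLpNorm_top_le_of_bound` /
`tendsto_eLpNorm_three_of_two` (`NSLerayHopfSereginProofs`) and the glue lemmas of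
`ClassicalSolutionGlue` — are reused here, not restated). Mathlib: `preimage_add_const_Icc`,
`ContinuousWithinAt.tendsto_nhdsWithin`, `nhdsWithin_union`, `UniqueDiffWithinAt.eq_deriv`,
`HasDerivWithinAt.congr_of_eventuallyEq`, `is_const_of_fderiv_eq_zero`, `memLp_const_iff`,
`measure_univ_of_isAddLeftInvariant`, `contDiffOn_of_locally_contDiffOn`, `derivWithin_inter`.

## References

* T. Tao, *Localisation and compactness properties of the Navier–Stokes global regularity
  problem*, Anal. PDE 6 (2013), 25–107 = arXiv:1108.1165, Thm. 5.4 (arXiv Thm. 31, p. 18).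
* P. G. Lemarié-Rieusset, *The Navier–Stokes Problem in the 21st Century*, CRC Press 2016,
  Thm. 7.2 and its proof (PDF p. 147); Thm. 7.7 (p. 147, uniqueness in `C([0,T); L³)`).
* J. C. Robinson, J. L. Rodrigo, W. Sadowski, *The Three-Dimensional Navier–Stokes Equations*,
  CUP 2016, proof of Lemma 6.11; Thm. 8.19 (weak–strong uniqueness).
* E. B. Fabes, B. F. Jones, N. M. Rivière, Arch. Rational Mech. Anal. 45 (1972), Thm. 2.1.
-/

noncomputable section

open MeasureTheory Set Function Filter Topology
open scoped ENNReal NNReal ContDiff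

namespace Literature.Analysis.FluidPDE

/-- Local notation for physical space `ℝ³ = EuclideanSpace ℝ (Fin 3)`. -/
local notation "ℝ³" => EuclideanSpace ℝ (Fin 3)

/-! ### Three lemmas on `C(S; L^q)` fields -/

section TimeContinuity

variable {X : Type*} [MeasureSpace X] {F : Type*} [NormedAddCommGroup F]
variable {S : Set ℝ} {q : ℝ≥0∞} {u v : ℝ → X → F}

/-- `C(S; L^q)` only depends on the values on `S`. [folklore] -/
theorem ContinuousInLpOn.congr_eqOn (h : ContinuousInLpOn S q u) (heq : ∀ t ∈ S, u t = v t) :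
    ContinuousInLpOn S q v := by
  refine ⟨fun t ht => heq t ht ▸ h.1 t ht, fun t₀ ht₀ => ?_⟩
  refine (h.2 t₀ ht₀).congr' ?_
  filter_upwards [self_mem_nhdsWithin] with t ht
  rw [heq t ht, heq t₀ ht₀]

/-- Time translation: `u ∈ C(S; L^q)` gives `u(· + a) ∈ C((· + a)⁻¹' S; L^q)`. [folklore] -/
theorem ContinuousInLpOn.comp_add_right (h : ContinuousInLpOn S q u) (a : ℝ) :
    ContinuousInLpOn ((· + a) ⁻¹' S) q (fun t => u (t + a)) := by
  refine ⟨fun t ht => h.1 (t + a) ht, fun t₀ ht₀ => ?_⟩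
  have hmap : Tendsto (· + a) (𝓝[(· + a) ⁻¹' S] t₀) (𝓝[S] (t₀ + a)) :=
    (continuous_id.add continuous_const).continuousWithinAt.tendsto_nhdsWithin
      (mapsTo_preimage _ _)
  exact (h.2 (t₀ + a) ht₀).comp hmap

/-- `C(S₁; L^q)` and `C(S₂; L^q)` give `C(S₁ ∪ S₂; L^q)` for closed `S₁`, `S₂`
(`𝓝[S₁ ∪ S₂] t = 𝓝[S₁] t ⊔ 𝓝[S₂] t`, and `𝓝[Sᵢ] t = ⊥` off the closed set `Sᵢ`). [folklore] -/
theorem ContinuousInLpOn.union_of_isClosed {S₁ S₂ : Set ℝ} (h₁ : ContinuousInLpOn S₁ q u)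
    (h₂ : ContinuousInLpOn S₂ q u) (hS₁ : IsClosed S₁) (hS₂ : IsClosed S₂) :
    ContinuousInLpOn (S₁ ∪ S₂) q u := by
  refine ⟨fun t ht => ht.elim (h₁.1 t) (h₂.1 t), fun t₀ ht₀ => ?_⟩
  rw [nhdsWithin_union]
  refine Tendsto.sup ?_ ?_
  · by_cases h : t₀ ∈ S₁
    · exact h₁.2 t₀ h
    · have hbot : 𝓝[S₁] t₀ = ⊥ := by
        rw [← notMem_closure_iff_nhdsWithin_eq_bot, hS₁.closure_eq]; exact h
      rw [hbot]; exact tendsto_bot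
  · by_cases h : t₀ ∈ S₂
    · exact h₂.2 t₀ h
    · have hbot : 𝓝[S₂] t₀ = ⊥ := by
        rw [← notMem_closure_iff_nhdsWithin_eq_bot, hS₂.closure_eq]; exact h
      rw [hbot]; exact tendsto_bot

end TimeContinuity

/-! ### `L²` functions with equal gradients are equal -/

/-- On `ℝ³` (infinite volume) two differentiable functions with the same derivative and finite
`∫⁻ ‖·‖ₑ²` are equal: their difference is a constant (mean value theorem) lying in `L²(ℝ³)`,
hence zero (`memLp_const_iff`, `volume univ = ∞`). [folklore] -/
theorem eq_of_fderiv_eq_of_lintegral_sq_lt_top {G : Type*} [NormedAddCommGroup G]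
    [NormedSpace ℝ G] {g₁ g₂ : ℝ³ → G} (hd₁ : Differentiable ℝ g₁) (hd₂ : Differentiable ℝ g₂)
    (hD : ∀ x, fderiv ℝ g₁ x = fderiv ℝ g₂ x) (h₁ : ∫⁻ x, ‖g₁ x‖ₑ ^ 2 < ⊤)
    (h₂ : ∫⁻ x, ‖g₂ x‖ₑ ^ 2 < ⊤) : g₁ = g₂ := by
  have hw : Differentiable ℝ (fun x => g₁ x - g₂ x) := hd₁.sub hd₂
  have hzero : ∀ x, fderiv ℝ (fun x => g₁ x - g₂ x) x = 0 := fun x => by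
    rw [fderiv_fun_sub (hd₁ x) (hd₂ x), hD x, sub_self]
  have hconst : ∀ x, g₁ x - g₂ x = g₁ 0 - g₂ 0 := fun x =>
    is_const_of_fderiv_eq_zero hw hzero x 0
  have hm₁ : MemLp g₁ 2 volume :=
    ⟨hd₁.continuous.aestronglyMeasurable, eLpNorm_two_lt_top_of_lintegral_enorm_sq_lt_top h₁⟩
  have hm₂ : MemLp g₂ 2 volume :=
    ⟨hd₂.continuous.aestronglyMeasurable, eLpNorm_two_lt_top_of_lintegral_enorm_sq_lt_top h₂⟩
  have hmc : MemLp (fun _ : ℝ³ => g₁ 0 - g₂ 0) 2 volume :=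
    (hm₁.sub hm₂).ae_eq (Eventually.of_forall fun x => by simpa using hconst x)
  rcases (memLp_const_iff two_ne_zero ENNReal.ofNat_ne_top).1 hmc with hc | hμ
  · funext x
    exact sub_eq_zero.1 ((hconst x).trans hc)
  · rw [measure_univ_of_isAddLeftInvariant] at hμ
    exact absurd hμ (lt_irrefl _)

/-! ### The class -/

/-- **Tao's smooth `H¹` class on the closed slab `[0, T] × ℝ³`** — field for field the
conclusion of the named fact `tao2011_smooth_local_existence` (Tao 2013, Thm. 5.4 (i), (ii),
(iv), `TaoH1LocalExistence.lean`): `(u, p)` is a classical solution of the unforced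
Navier–Stokes system with viscosity `ν` on `[0, T] × ℝ³` (`IsClassicalNSSolutionOn (Icc 0 T)`,
jointly `C^∞` up to `t = 0` and `t = T`, one-sided time derivative within `[0, T]`) with
`u 0 = u₀`; `u`, `∂ₜu` (`timeDerivWithin (Icc 0 T) u`) and `p` have all `L²` Sobolev norms
bounded on `[0, T]` (`u, ∂ₜu, p ∈ L^∞_t H^k_x`, all `k`); and `u ∈ C([0, T]; L²)`. A packaging
predicate (see `isTaoSolutionOn_iff`); meaningful for `0 < T`. [cite: Tao2011, Thm. 5.4 (ii)+(iv)] -/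
structure IsTaoSolutionOn (T ν : ℝ) (u₀ : ℝ³ → ℝ³) (u : ℝ → ℝ³ → ℝ³) (p : ℝ → ℝ³ → ℝ) :
    Prop where
  /-- `(u, p)` is a classical solution on the closed slab `[0, T] × ℝ³`. -/
  classical : IsClassicalNSSolutionOn (Icc 0 T) ν 0 u p
  /-- The datum. -/
  initial : u 0 = u₀
  /-- `u ∈ L^∞_t H^k_x([0, T] × ℝ³)` for all `k`. -/
  sobolev : HasBoundedSobolevNormsOn (Icc 0 T) u
  /-- `∂ₜu ∈ L^∞_t H^k_x([0, T] × ℝ³)` for all `k` (one-sided derivative within `[0, T]`). -/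
  sobolev_dt : HasBoundedSobolevNormsOn (Icc 0 T) (timeDerivWithin (Icc 0 T) u)
  /-- `p ∈ L^∞_t H^k_x([0, T] × ℝ³)` for all `k`. -/
  sobolev_p : ∀ n : ℕ, ∃ C : ℝ≥0, ∀ t ∈ Icc 0 T, ∫⁻ x, ‖iteratedFDeriv ℝ n (p t) x‖ₑ ^ 2 ≤ C
  /-- `u ∈ C([0, T]; L²)`. -/
  continuousL2 : ContinuousInLpOn (Icc 0 T) 2 u

/-- Unfolding of `IsTaoSolutionOn` into the conjunction printed by
`tao2011_smooth_local_existence`. [folklore] -/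
theorem isTaoSolutionOn_iff {T ν : ℝ} {u₀ : ℝ³ → ℝ³} {u : ℝ → ℝ³ → ℝ³} {p : ℝ → ℝ³ → ℝ} :
    IsTaoSolutionOn T ν u₀ u p ↔
      IsClassicalNSSolutionOn (Icc 0 T) ν 0 u p ∧ u 0 = u₀ ∧
        HasBoundedSobolevNormsOn (Icc 0 T) u ∧
        HasBoundedSobolevNormsOn (Icc 0 T) (timeDerivWithin (Icc 0 T) u) ∧
        (∀ n : ℕ, ∃ C : ℝ≥0, ∀ t ∈ Icc 0 T, ∫⁻ x, ‖iteratedFDeriv ℝ n (p t) x‖ₑ ^ 2 ≤ C) ∧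
        ContinuousInLpOn (Icc 0 T) 2 u :=
  ⟨fun h => ⟨h.classical, h.initial, h.sobolev, h.sobolev_dt, h.sobolev_p, h.continuousL2⟩,
    fun h => ⟨h.1, h.2.1, h.2.2.1, h.2.2.2.1, h.2.2.2.2.1, h.2.2.2.2.2⟩⟩

/-- **Tao 2013, Thm. 5.4 (ii)+(iv), repackaged**: the named fact `tao2011_smooth_local_existence`
produces Tao-class solutions — for smooth divergence-free `H^∞` data `a` with
`‖a‖²_{L²} + ‖∇a‖²_{L²} ≤ A` there is a Tao-class solution from `a` on `[0, T]` whenever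
`A² T ≤ c ν³`. [cite: Tao2011, Thm. 5.4 (ii)+(iv)] -/
theorem IsTaoSolutionOn.of_tao (hE : tao2011_smooth_local_existence) :
    ∃ c : ℝ, 0 < c ∧ ∀ ⦃ν T : ℝ⦄, 0 < ν → 0 < T → ∀ ⦃a : ℝ³ → ℝ³⦄,
      ContDiff ℝ ∞ a → VectorCalculus.IsDivFree a →
      (∀ n : ℕ, ∫⁻ x, ‖iteratedFDeriv ℝ n a x‖ₑ ^ 2 < ⊤) →
      ∀ ⦃A : ℝ⦄, 0 ≤ A →
        (∫⁻ x, ‖a x‖ₑ ^ 2) + (∫⁻ x, ENNReal.ofReal (frobeniusNormSq (fderiv ℝ a x))) ≤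
            ENNReal.ofReal A →
        A ^ 2 * T ≤ c * ν ^ 3 →
        ∃ (u : ℝ → ℝ³ → ℝ³) (p : ℝ → ℝ³ → ℝ), IsTaoSolutionOn T ν a u p := by
  obtain ⟨c, hc, h⟩ := hE
  refine ⟨c, hc, fun ν T hν hT a ha hdiv hH A hA hAle hT' => ?_⟩
  obtain ⟨u, p, h1, h2, h3, h4, h5, h6⟩ := h hν hT ha hdiv hH hA hAle hT'
  exact ⟨u, p, ⟨h1, h2, h3, h4, h5, h6⟩⟩

namespace IsTaoSolutionOn

variable {T ν : ℝ} {u₀ : ℝ³ → ℝ³} {u : ℝ → ℝ³ → ℝ³} {p : ℝ → ℝ³ → ℝ}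

/-! ### Bounds, Leray–Hopf, mild, `C_t L³` -/

/-- The velocity of a Tao-class solution is bounded on `[0, T] × ℝ³` (Sobolev imbedding
`H² ⊂ C_B`, `exists_forall_norm_le_of_hasBoundedSobolevNormsOn`). [cite: AdamsFournier2003, Thm. 4.12 Part I Case A] -/
theorem exists_bound_velocity (h : IsTaoSolutionOn T ν u₀ u p) :
    ∃ B : ℝ, 0 ≤ B ∧ ∀ t ∈ Icc 0 T, ∀ x, ‖u t x‖ ≤ B :=
  exists_forall_norm_le_of_hasBoundedSobolevNormsOn h.classical h.sobolev

/-- The pressure of a Tao-class solution is bounded on `[0, T] × ℝ³` (Sobolev imbedding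
`H² ⊂ C_B` for scalar functions, `FunctionSpaces.exists_enorm_le_sobolev_two_two_dim_three`, and
the `L²` bounds on `p`, `Dp`, `D²p`). [cite: AdamsFournier2003, Thm. 4.12 Part I Case A] -/
theorem exists_bound_pressure (h : IsTaoSolutionOn T ν u₀ u p) :
    ∃ P : ℝ, 0 ≤ P ∧ ∀ t ∈ Icc 0 T, ∀ x, ‖p t x‖ ≤ P := by
  obtain ⟨K, hK, hbound⟩ := FunctionSpaces.exists_enorm_le_sobolev_two_two_dim_three
    (E := ℝ³) (F := ℝ) (volume : Measure ℝ³) finrank_euclideanSpace_fin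
  choose C hC using h.sobolev_p
  set R : ℝ≥0∞ := K * ∑ j ∈ Finset.range 3, ((C j : ℝ≥0∞) ^ (1 / 2 : ℝ)) with hR
  have hRtop : R < ⊤ := by
    refine ENNReal.mul_lt_top hK (ENNReal.sum_lt_top.2 fun j _ => ?_)
    exact ENNReal.rpow_lt_top_of_nonneg (by norm_num) ENNReal.coe_ne_top
  refine ⟨R.toReal, ENNReal.toReal_nonneg, fun t ht x => ?_⟩
  have h1 : ‖p t x‖ₑ ≤ R := by
    refine (hbound (p t) ((h.classical.contDiff_pressure ht).of_le (by norm_cast)) x).trans ?_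
    rw [hR]
    gcongr with j hj
    exact eLpNorm_two_le_rpow_of_lintegral_sq_le (hC j t ht)
  calc ‖p t x‖ = (‖p t x‖ₑ).toReal := (toReal_enorm (p t x)).symm
    _ ≤ R.toReal := ENNReal.toReal_mono hRtop.ne h1

/-- `u` is bounded on `[0, T]` in the sense of `IsBoundedOn`. [folklore] -/
theorem isBoundedOn_velocity (h : IsTaoSolutionOn T ν u₀ u p) : IsBoundedOn (Icc 0 T) u := by
  obtain ⟨B, -, hB⟩ := h.exists_bound_velocity
  exact ⟨B, hB⟩

/-- `p` is bounded on `[0, T]` in the sense of `IsBoundedOn`. [folklore] -/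
theorem isBoundedOn_pressure (h : IsTaoSolutionOn T ν u₀ u p) : IsBoundedOn (Icc 0 T) p := by
  obtain ⟨P, -, hP⟩ := h.exists_bound_pressure
  exact ⟨P, hP⟩

/-- **Tao-class solutions are Leray–Hopf** on `[0, T]` from `u₀` (finite energy, `∇u ∈ L²`,
`u ∈ L³`, `pu ∈ L¹` on the slab; the tree's `isLerayHopfOn_of_hasBoundedSobolevNormsOn`, i.e.
Leray 1934, §32 / the proved `IsClassicalNSSolutionOn.isLerayHopfOn_holds`). [cite: Leray1934, §32] -/
theorem isLerayHopfOn (h : IsTaoSolutionOn T ν u₀ u p) (hT : 0 < T) :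
    IsLerayHopfOn T ν 0 u₀ u := by
  have hLH := isLerayHopfOn_of_hasBoundedSobolevNormsOn hT h.classical h.sobolev h.sobolev_p
    h.continuousL2
  rwa [h.initial] at hLH

/-- Energy bound: `∫ |u(t)|² ≤ 2 E(u₀) = ∫ |u₀|²` on `[0, T]` (Leray–Hopf energy inequality). [cite: Leray1934, §32] -/
theorem lintegral_enorm_sq_le (h : IsTaoSolutionOn T ν u₀ u p) (hT : 0 < T) (hν : 0 ≤ ν)
    {t : ℝ} (ht : t ∈ Icc 0 T) :
    ∫⁻ x, ‖u t x‖ₑ ^ 2 ≤ ENNReal.ofReal (2 * VectorCalculus.kineticEnergy u₀) :=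
  (h.isLerayHopfOn hT).lintegral_enorm_sq_le hν ht

/-- **Tao-class solutions are mild solutions** (duality form) on `[0, T]` from `u₀`: classical
solutions with `u`, `p` bounded are mild (Fabes–Jones–Rivière 1972, Thm. 2.1 (i); the proved
`IsClassicalNSSolutionOn.isMildNSSolutionOn_holds`). [cite: FabesJonesRiviere1972, Thm. 2.1 (i)] -/
theorem isMildNSSolutionOn (h : IsTaoSolutionOn T ν u₀ u p) (hν : 0 < ν) :
    IsMildNSSolutionOn (Icc 0 T) ν 0 u₀ u := by
  have hf : IsBoundedOn (Icc 0 T) (0 : ℝ → ℝ³ → ℝ³) := ⟨0, fun t _ x => by simp⟩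
  have hm := IsClassicalNSSolutionOn.isMildNSSolutionOn_holds h.classical hν Subset.rfl
    h.isBoundedOn_velocity h.isBoundedOn_pressure hf
  rwa [h.initial] at hm

/-- The slices of a Tao-class solution are (strongly) measurable. [folklore] -/
theorem aestronglyMeasurable_slice (h : IsTaoSolutionOn T ν u₀ u p) {t : ℝ} (ht : t ∈ Icc 0 T) :
    AEStronglyMeasurable (u t) volume :=
  (h.classical.contDiff_velocity ht).continuous.aestronglyMeasurable

/-- **`L^∞ ∩ C_tL² ⊂ C_tL³`**: a Tao-class solution is in `C([0, T]; L³)`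
(`‖w‖₃³ ≤ ‖w‖_∞‖w‖₂²`; the tree's `eLpNorm_three_pow_le`, `tendsto_eLpNorm_three_of_two`). [folklore] -/
theorem continuousInLpOn_three (h : IsTaoSolutionOn T ν u₀ u p) :
    ContinuousInLpOn (Icc 0 T) 3 u := by
  obtain ⟨B, -, hB⟩ := h.exists_bound_velocity
  have hmeas : ∀ t ∈ Icc 0 T, AEStronglyMeasurable (u t) volume := fun t ht =>
    h.aestronglyMeasurable_slice ht
  refine ⟨fun t ht => ⟨hmeas t ht, ?_⟩, fun t₀ ht₀ =>
    tendsto_eLpNorm_three_of_two hmeas hB ht₀ (h.continuousL2.2 t₀ ht₀)⟩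
  have h2 : MemLp (u t) 2 volume := h.continuousL2.1 t ht
  have htop : eLpNorm (u t) ∞ volume ≤ ENNReal.ofReal B := eLpNorm_top_le_of_bound (hB t ht)
  have h3 : eLpNorm (u t) 3 volume ^ 3 ≤ eLpNorm (u t) ∞ volume * eLpNorm (u t) 2 volume ^ 2 :=
    eLpNorm_three_pow_le (hmeas t ht)
  have hfin : eLpNorm (u t) ∞ volume * eLpNorm (u t) 2 volume ^ 2 < ⊤ :=
    ENNReal.mul_lt_top (htop.trans_lt ENNReal.ofReal_lt_top) (ENNReal.pow_lt_top h2.eLpNorm_lt_top)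
  by_contra hnot
  rw [not_lt, top_le_iff] at hnot
  rw [hnot, ENNReal.top_pow (by norm_num)] at h3
  exact absurd (h3.trans_lt hfin) (lt_irrefl _)

/-- The velocity of a Tao-class solution is measurable on `(0, T) × ℝ³` (it is continuous on
the closed slab). [folklore] -/
theorem aestronglyMeasurable_uncurry (h : IsTaoSolutionOn T ν u₀ u p) :
    AEStronglyMeasurable (uncurry u) (volume.restrict (Ioo 0 T ×ˢ univ)) :=
  (h.classical.smooth_velocity.continuousOn.mono
    (prod_mono Ioo_subset_Icc_self Subset.rfl)).aestronglyMeasurable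
    (measurableSet_Ioo.prod MeasurableSet.univ)

/-- The datum of a Tao-class solution (`0 ≤ T`) is in `L³`. [folklore] -/
theorem memLp_three_initial (h : IsTaoSolutionOn T ν u₀ u p) (hT : 0 ≤ T) : MemLp u₀ 3 volume :=
  h.initial ▸ h.continuousInLpOn_three.1 0 ⟨le_rfl, hT⟩

/-- The slices of a Tao-class solution are smooth, divergence free and in `H^∞`. [folklore] -/
theorem slice (h : IsTaoSolutionOn T ν u₀ u p) {t : ℝ} (ht : t ∈ Icc 0 T) :
    ContDiff ℝ ∞ (u t) ∧ VectorCalculus.IsDivFree (u t) ∧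
      ∀ n : ℕ, ∫⁻ x, ‖iteratedFDeriv ℝ n (u t) x‖ₑ ^ 2 < ⊤ :=
  ⟨h.classical.contDiff_velocity ht, h.classical.divFree t ht, fun n => by
    obtain ⟨C, hC⟩ := h.sobolev n
    exact (hC t ht).trans_lt ENNReal.coe_lt_top⟩

/-! ### Identification with a Kato solution -/

/-- **A Tao-class solution is the Kato solution.** If `w ∈ C([0, T); L³)` is a mild solution
of the unforced system from the same datum `u₀`, measurable on `(0, T) × ℝ³` (the class of
`HasGlobalKatoSolution` / `kato_local`), then `u t = w t` a.e. for every `t ∈ [0, T)`: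
the Tao-class solution is itself a mild solution in `C([0, T); L³)` (`isMildNSSolutionOn`,
`continuousInLpOn_three`), and mild solutions in this class are unique — the theorem of
Furioli–Lemarié-Rieusset–Terraneo (Rev. Mat. Iberoam. 16 (2000), Thm. 1; Lemarié-Rieusset 2016,
Thm. 7.7), proved in the tree as `kato_unique_holds`. [cite: FurioliLemarierieussetTerraneo2000, Théorème 1, p. 606] -/
theorem ae_eq_of_kato (h : IsTaoSolutionOn T ν u₀ u p) (hν : 0 < ν) {w : ℝ → ℝ³ → ℝ³}
    (hw : IsMildNSSolutionOn (Ico 0 T) ν 0 u₀ w) (hwc : ContinuousInLpOn (Ico 0 T) 3 w)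
    (hwm : AEStronglyMeasurable (uncurry w) (volume.restrict (Ioo 0 T ×ˢ univ))) :
    ∀ t ∈ Ico 0 T, u t =ᵐ[volume] w t := by
  rcases le_or_gt T 0 with hT | hT
  · intro t ht
    exact absurd (ht.1.trans_lt ht.2) (not_lt.2 hT)
  exact kato_unique_holds hν (h.memLp_three_initial hT.le)
    ((h.isMildNSSolutionOn hν).mono Ico_subset_Icc_self) hw
    (h.continuousInLpOn_three.mono Ico_subset_Icc_self) hwc h.aestronglyMeasurable_uncurry hwm

/-! ### Restriction and translation -/

/-- **Restriction to `[0, T']`, `0 < T' ≤ T`.** The one-sided time derivative within the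
smaller slab agrees with the one within `[0, T]` (`IsSmoothSpaceTimeOn.timeDerivWithin_eq_of_subset`),
so all bounds are inherited. [folklore] -/
theorem mono (h : IsTaoSolutionOn T ν u₀ u p) {T' : ℝ} (hT' : 0 < T') (hle : T' ≤ T) :
    IsTaoSolutionOn T' ν u₀ u p where
  classical := h.classical.mono (Icc_subset_Icc_right hle) (uniqueDiffOn_Icc hT')
  initial := h.initial
  sobolev := h.sobolev.mono (Icc_subset_Icc_right hle)
  sobolev_dt n := by
    obtain ⟨C, hC⟩ := h.sobolev_dt n
    refine ⟨C, fun t ht => ?_⟩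
    have heq : timeDerivWithin (Icc 0 T') u t = timeDerivWithin (Icc 0 T) u t := funext fun x =>
      h.classical.smooth_velocity.timeDerivWithin_eq_of_subset (Icc_subset_Icc_right hle)
        (uniqueDiffOn_Icc hT') ht x
    rw [heq]
    exact hC t (Icc_subset_Icc_right hle ht)
  sobolev_p n := (h.sobolev_p n).imp fun _ hC t ht => hC t (Icc_subset_Icc_right hle ht)
  continuousL2 := h.continuousL2.mono (Icc_subset_Icc_right hle)

/-- **Restart from a later time.** For `0 ≤ a < T` the translate `(u(· + a), p(· + a))` is a
Tao-class solution on `[0, T - a]` from the datum `u a` (the system is autonomous; the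
one-sided derivative within `[0, T - a]` of the translate is the derivative of `u` within
`[0, T]`, `timeDerivWithin_comp_add_right`). [folklore] -/
theorem translate (h : IsTaoSolutionOn T ν u₀ u p) {a : ℝ} (ha : 0 ≤ a) (haT : a < T) :
    IsTaoSolutionOn (T - a) ν (u a) (fun t => u (t + a)) (fun t => p (t + a)) := by
  have hTa : 0 < T - a := by linarith
  have hpre : (· + a) ⁻¹' Icc 0 T = Icc (0 - a) (T - a) := preimage_add_const_Icc a 0 T
  have hsub : Icc 0 (T - a) ⊆ (· + a) ⁻¹' Icc 0 T := by
    rw [hpre]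
    exact Icc_subset_Icc_left (by linarith)
  have hmem : ∀ {t : ℝ}, t ∈ Icc 0 (T - a) → t + a ∈ Icc 0 T := fun ht => hsub ht
  have hcl : IsClassicalNSSolutionOn (Icc 0 (T - a)) ν 0 (fun t => u (t + a))
      (fun t => p (t + a)) :=
    (h.classical.comp_add_right a).mono hsub (uniqueDiffOn_Icc hTa)
  refine ⟨hcl, by simp, fun n => ?_, fun n => ?_, fun n => ?_, ?_⟩
  · obtain ⟨C, hC⟩ := h.sobolev n
    exact ⟨C, fun t ht => hC (t + a) (hmem ht)⟩
  · obtain ⟨C, hC⟩ := h.sobolev_dt n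
    refine ⟨C, fun t ht => ?_⟩
    have heq : timeDerivWithin (Icc 0 (T - a)) (fun s => u (s + a)) t =
        timeDerivWithin (Icc 0 T) u (t + a) := by
      funext x
      rw [← timeDerivWithin_comp_add_right (Icc 0 T) u a t x]
      exact (h.classical.smooth_velocity.comp_add_right a).timeDerivWithin_eq_of_subset hsub
        (uniqueDiffOn_Icc hTa) ht x
    rw [heq]
    exact hC (t + a) (hmem ht)
  · obtain ⟨C, hC⟩ := h.sobolev_p n
    exact ⟨C, fun t ht => hC (t + a) (hmem ht)⟩
  · exact (h.continuousL2.comp_add_right a).mono hsub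

/-! ### Uniqueness in the class (Prodi–Serrin) -/

/-- **Two Tao-class solutions from the same datum coincide on the common slab** `[0, min T₁ T₂)`:
both are bounded Leray–Hopf solutions from `u₀ ∈ L²`, so the proved Prodi–Serrin weak–strong
uniqueness theorem applies (`eq_restart_of_serrin` with `serrin_weak_strong_uniqueness_holds`;
Prodi 1959, Serrin 1963; Robinson–Rodrigo–Sadowski 2016, Thm. 8.19), and continuous slices which
agree a.e. agree everywhere. [cite: RobinsonRodrigoSadowski2016, Thm. 8.19] -/
theorem eq_of_isTaoSolutionOn {T₁ T₂ : ℝ} {u₁ u₂ : ℝ → ℝ³ → ℝ³} {p₁ p₂ : ℝ → ℝ³ → ℝ}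
    (h₁ : IsTaoSolutionOn T₁ ν u₀ u₁ p₁) (h₂ : IsTaoSolutionOn T₂ ν u₀ u₂ p₂) (hν : 0 < ν)
    (hT₁ : 0 < T₁) (hT₂ : 0 < T₂) : ∀ t ∈ Ico 0 (min T₁ T₂), u₁ t = u₂ t := by
  have hsol : IsClassicalNSSolutionOn (Ico 0 T₁) ν 0 u₁ p₁ :=
    h₁.classical.mono Ico_subset_Icc_self (uniqueDiffOn_Ico 0 T₁)
  have hLH₁ : IsLerayHopfOn T₁ ν 0 (u₁ 0) u₁ := by
    have h := h₁.isLerayHopfOn hT₁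
    rwa [← h₁.initial] at h
  have hLH : IsLerayHopfOn (T₁ - 0) ν 0 (u₁ 0) (fun t => u₁ (t + 0)) := by
    simpa using hLH₁
  have hv0 : u₂ 0 = u₁ 0 := by rw [h₂.initial, h₁.initial]
  have heq := eq_restart_of_serrin serrin_weak_strong_uniqueness_holds hν hT₂ le_rfl hT₁ hsol hLH
    h₂.classical hv0 h₂.sobolev h₂.sobolev_p h₂.continuousL2
  intro t ht
  have ht' : t ∈ Ico 0 (min T₂ (T₁ - 0)) := ⟨ht.1, by rw [sub_zero, min_comm]; exact ht.2⟩
  simpa using heq t ht'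

/-! ### The velocity determines the pressure -/

/-- **The velocity determines the pressure gradient — boundary-capable version.** Let
`(u₁, p₁)`, `(u₂, p₂)` be classical solutions (same `ν`, same force) on time sets `S₁`, `S₂`,
and let the velocities agree on a set `S ⊆ S₁ ∩ S₂` containing `t` which has unique
differentiability at `t` (e.g. `S = [0, m]`, also at `t = 0`). Then `∇p₁(t, ·) = ∇p₂(t, ·)`:
the one-sided time derivatives of `s ↦ uᵢ s x` within `Sᵢ` at `t` are both derivatives within
`S`, where the two functions agree, hence equal (`UniqueDiffWithinAt.eq_deriv`); subtract the
momentum equations. Interior-time version: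
`IsClassicalNSSolutionOn.gradient_pressure_eq_of_eventuallyEq` (`ClassicalSolutionGlue`). [folklore] -/
theorem _root_.Literature.Analysis.FluidPDE.IsClassicalNSSolutionOn.gradient_pressure_eq_of_eqOn
    {E : Type*} [NormedAddCommGroup E] [InnerProductSpace ℝ E] [FiniteDimensional ℝ E]
    {S₁ S₂ S : Set ℝ} {f u₁ u₂ : ℝ → E → E} {p₁ p₂ : ℝ → E → ℝ}
    (h₁ : IsClassicalNSSolutionOn S₁ ν f u₁ p₁) (h₂ : IsClassicalNSSolutionOn S₂ ν f u₂ p₂)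
    (hS₁ : S ⊆ S₁) (hS₂ : S ⊆ S₂) {t : ℝ} (ht : t ∈ S) (hU : UniqueDiffWithinAt ℝ S t)
    (heq : ∀ s ∈ S, u₁ s = u₂ s) (x : E) :
    gradient (p₁ t) x = gradient (p₂ t) x := by
  have heqt : u₁ t = u₂ t := heq t ht
  -- the two one-sided derivatives agree
  have hd : timeDerivWithin S₁ u₁ t x = timeDerivWithin S₂ u₂ t x := by
    simp only [timeDerivWithin_apply]
    have g₁ : HasDerivWithinAt (fun s => u₁ s x) (derivWithin (fun s => u₁ s x) S₁ t) S₁ t :=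
      (h₁.smooth_velocity.differentiableWithinAt_time (hS₁ ht) x).hasDerivWithinAt
    have g₂ : HasDerivWithinAt (fun s => u₂ s x) (derivWithin (fun s => u₂ s x) S₂ t) S₂ t :=
      (h₂.smooth_velocity.differentiableWithinAt_time (hS₂ ht) x).hasDerivWithinAt
    have g₁' : HasDerivWithinAt (fun s => u₂ s x) (derivWithin (fun s => u₁ s x) S₁ t) S t :=
      (g₁.mono hS₁).congr_of_eventuallyEq
        (eventually_nhdsWithin_of_forall fun s hs => by
          show u₂ s x = u₁ s x
          rw [heq s hs]) (by rw [heqt])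
    exact hU.eq_deriv _ g₁' (g₂.mono hS₂)
  have hm₁ := h₁.momentum t (hS₁ ht) x
  have hm₂ := h₂.momentum t (hS₂ ht) x
  rw [hd, heqt] at hm₁
  have h12 := hm₁.symm.trans hm₂
  simpa using h12

/-- **In Tao's class the velocity determines the pressure.** If two Tao-class solutions have
velocities agreeing on `[0, m]`, `0 < m ≤ min T₁ T₂`, then their pressures agree on `[0, m]`:
the gradients agree (`gradient_pressure_eq_of_eqOn` with `S = [0, m]`, also at `t = 0` and
`t = m`), and two `L²(ℝ³)` functions with the same gradient are equal
(`eq_of_fderiv_eq_of_lintegral_sq_lt_top`). [folklore] -/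
theorem pressure_eq {T₁ T₂ : ℝ} {u₀₁ u₀₂ : ℝ³ → ℝ³} {u₁ u₂ : ℝ → ℝ³ → ℝ³}
    {p₁ p₂ : ℝ → ℝ³ → ℝ} (h₁ : IsTaoSolutionOn T₁ ν u₀₁ u₁ p₁)
    (h₂ : IsTaoSolutionOn T₂ ν u₀₂ u₂ p₂) {m : ℝ} (hm : 0 < m) (hm₁ : m ≤ T₁) (hm₂ : m ≤ T₂)
    (heq : ∀ s ∈ Icc 0 m, u₁ s = u₂ s) : ∀ t ∈ Icc 0 m, p₁ t = p₂ t := by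
  intro t htI
  have ht₁ : t ∈ Icc 0 T₁ := ⟨htI.1, htI.2.trans hm₁⟩
  have ht₂ : t ∈ Icc 0 T₂ := ⟨htI.1, htI.2.trans hm₂⟩
  have hS₁ : Icc 0 m ⊆ Icc 0 T₁ := Icc_subset_Icc_right hm₁
  have hS₂ : Icc 0 m ⊆ Icc 0 T₂ := Icc_subset_Icc_right hm₂
  have hgrad : ∀ x, gradient (p₁ t) x = gradient (p₂ t) x := fun x =>
    h₁.classical.gradient_pressure_eq_of_eqOn h₂.classical hS₁ hS₂ htI
      (uniqueDiffOn_Icc hm t htI) heq x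
  have hd₁ : Differentiable ℝ (p₁ t) := (h₁.classical.contDiff_pressure ht₁).differentiable (by simp)
  have hd₂ : Differentiable ℝ (p₂ t) := (h₂.classical.contDiff_pressure ht₂).differentiable (by simp)
  have hD : ∀ x, fderiv ℝ (p₁ t) x = fderiv ℝ (p₂ t) x := fun x => by
    have hg := hgrad x
    unfold gradient at hg
    exact (InnerProductSpace.toDual ℝ ℝ³).symm.injective hg
  have hL2 : ∀ {T' : ℝ} {u₀' : ℝ³ → ℝ³} {u' : ℝ → ℝ³ → ℝ³} {p' : ℝ → ℝ³ → ℝ},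
      IsTaoSolutionOn T' ν u₀' u' p' → t ∈ Icc 0 T' → ∫⁻ x, ‖p' t x‖ₑ ^ 2 < ⊤ := by
    intro T' u₀' u' p' h' ht'
    obtain ⟨C, hC⟩ := h'.sobolev_p 0
    refine lt_of_le_of_lt (le_of_eq (lintegral_congr fun x => ?_))
      ((hC t ht').trans_lt ENNReal.coe_lt_top)
    rw [← ofReal_norm, ← ofReal_norm, norm_iteratedFDeriv_zero]
  exact eq_of_fderiv_eq_of_lintegral_sq_lt_top hd₁ hd₂ hD (hL2 h₁ ht₁) (hL2 h₂ ht₂)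

/-! ### Gluing -/

/-- **Gluing a restart onto a Tao-class solution.** Let `(u₁, p₁)` be a Tao-class solution on
`[0, T₁]` from `u₀` and `(u₂, p₂)` a Tao-class solution on `[0, T₂]` from the restart datum
`u₁ a`, where `0 ≤ a < T₁ ≤ a + T₂`. Then the fields equal to `(u₁, p₁)` for `t < T₁` and to
`(u₂(· - a), p₂(· - a))` for `t ≥ T₁` form a Tao-class solution on `[0, a + T₂]` from `u₀`.
Indeed `u₁ = u₂(· - a)` on `[a, T₁)` (`eq_of_isTaoSolutionOn` for the translate
`u₁(· + a)` and `u₂`, Prodi–Serrin) and then `p₁ = p₂(· - a)` there (`pressure_eq`: equal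
gradients, both in `L²`); joint smoothness and the momentum equation are local statements, the
two pieces `[0, T₁)` and `(a, a + T₂]` being relatively open in `[0, a + T₂]`
(cf. `IsClassicalNSSolutionOn.glue` of `ClassicalSolutionGlue`, the half-open, renormalised
version); all bounds are maxima of the bounds of the two pieces, and `L²`-continuity in time
holds on the closed pieces `[0, (a + T₁)/2]` and `[a, a + T₂]`. This is the restart step in the
proof of Lemarié-Rieusset 2016, Thm. 7.2 (PDF p. 147), for classical solutions on closed
slabs. [cite: LemarieRieusset2016, Thm. 7.2 (proof), PDF p. 147] -/
theorem glue {T₁ T₂ a : ℝ} {u₁ u₂ : ℝ → ℝ³ → ℝ³} {p₁ p₂ : ℝ → ℝ³ → ℝ}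
    (h₁ : IsTaoSolutionOn T₁ ν u₀ u₁ p₁) (h₂ : IsTaoSolutionOn T₂ ν (u₁ a) u₂ p₂) (hν : 0 < ν)
    (hT₂ : 0 < T₂) (ha : 0 ≤ a) (haT : a < T₁) (hT : T₁ ≤ a + T₂) :
    IsTaoSolutionOn (a + T₂) ν u₀ (fun t => if t < T₁ then u₁ t else u₂ (t - a))
      (fun t => if t < T₁ then p₁ t else p₂ (t - a)) := by
  set b : ℝ := a + T₂ with hb
  have hT₁ : 0 < T₁ := ha.trans_lt haT
  have hT₁a : 0 < T₁ - a := by linarith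
  have hT₁b : T₁ ≤ b := hT
  -- the translate of `(u₁, p₁)` by `a`
  have h₁a := h₁.translate ha haT
  /- velocity agreement on the overlap `[a, T₁)` -/
  have hV : ∀ t ∈ Ico a T₁, u₁ t = u₂ (t - a) := by
    intro t ht
    have hs : t - a ∈ Ico 0 (min (T₁ - a) T₂) :=
      ⟨by linarith [ht.1], lt_min (by linarith [ht.2]) (by linarith [ht.2])⟩
    have := eq_of_isTaoSolutionOn h₁a h₂ hν hT₁a hT₂ (t - a) hs
    simpa using this
  /- pressure agreement on the overlap `[a, T₁)` -/
  have hP : ∀ t ∈ Ico a T₁, p₁ t = p₂ (t - a) := by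
    intro t ht
    set m : ℝ := (t - a + (T₁ - a)) / 2 with hm
    have hm0 : 0 < m := by rw [hm]; linarith [ht.1, ht.2]
    have hm₁ : m ≤ T₁ - a := by rw [hm]; linarith [ht.2]
    have hm₂ : m ≤ T₂ := by linarith
    have hVm : ∀ s ∈ Icc 0 m, u₁ (s + a) = u₂ s := by
      intro s hs
      have := hV (s + a) ⟨by linarith [hs.1], by linarith [hs.2, ht.2]⟩
      simpa using this
    have := pressure_eq h₁a h₂ hm0 hm₁ hm₂ hVm (t - a) ⟨by linarith [ht.1], by rw [hm]; linarith [ht.2]⟩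
    simpa using this
  /- pointwise descriptions of the glued fields -/
  set w : ℝ → ℝ³ → ℝ³ := fun t => if t < T₁ then u₁ t else u₂ (t - a) with hw
  set q : ℝ → ℝ³ → ℝ := fun t => if t < T₁ then p₁ t else p₂ (t - a) with hq
  have hw₁ : ∀ t, t < T₁ → w t = u₁ t := fun t ht => by simp only [hw, if_pos ht]
  have hq₁ : ∀ t, t < T₁ → q t = p₁ t := fun t ht => by simp only [hq, if_pos ht]
  have hw₂ : ∀ t, a ≤ t → w t = u₂ (t - a) := fun t ht => by
    by_cases htT : t < T₁
    · rw [hw₁ t htT, hV t ⟨ht, htT⟩]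
    · simp only [hw, if_neg htT]
  have hq₂ : ∀ t, a ≤ t → q t = p₂ (t - a) := fun t ht => by
    by_cases htT : t < T₁
    · rw [hq₁ t htT, hP t ⟨ht, htT⟩]
    · simp only [hq, if_neg htT]
  /- the two relatively open pieces -/
  have hI₁ : Icc 0 b ∩ Iio T₁ = Icc 0 T₁ ∩ Iio T₁ := Set.ext fun τ => by
    simp only [mem_inter_iff, mem_Icc, mem_Iio]
    constructor <;> rintro ⟨⟨h0, -⟩, hτ⟩ <;> exact ⟨⟨h0, by linarith⟩, hτ⟩
  have hpre : (· + -a) ⁻¹' Icc 0 T₂ = Icc a b := by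
    rw [preimage_add_const_Icc]; congr 1 <;> simp [hb, add_comm]
  have hI₂ : Icc 0 b ∩ Ioi a = ((· + -a) ⁻¹' Icc 0 T₂) ∩ Ioi a := Set.ext fun τ => by
    rw [hpre]
    simp only [mem_inter_iff, mem_Icc, mem_Ioi]
    constructor <;> rintro ⟨⟨h0, hτb⟩, hτ⟩ <;> exact ⟨⟨by linarith, hτb⟩, hτ⟩
  -- smoothness of the translates of `u₂`, `p₂` on `[a, b] × ℝ³`
  have hsm₂u : ContDiffOn ℝ ∞ (uncurry fun t => u₂ (t - a)) (Icc a b ×ˢ univ) := by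
    have h : ContDiffOn ℝ ∞ (uncurry fun t => u₂ (t + -a)) (((· + -a) ⁻¹' Icc 0 T₂) ×ˢ univ) :=
      h₂.classical.smooth_velocity.comp_add_right (-a)
    rw [hpre] at h
    simpa [sub_eq_add_neg] using h
  have hsm₂p : ContDiffOn ℝ ∞ (uncurry fun t => p₂ (t - a)) (Icc a b ×ˢ univ) := by
    have h : ContDiffOn ℝ ∞ (uncurry fun t => p₂ (t + -a)) (((· + -a) ⁻¹' Icc 0 T₂) ×ˢ univ) :=
      h₂.classical.smooth_pressure.comp_add_right (-a)
    rw [hpre] at h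
    simpa [sub_eq_add_neg] using h
  /- joint smoothness of the glued fields (local) -/
  have hsmooth : ∀ {F : Type} [NormedAddCommGroup F] [NormedSpace ℝ F]
      {g g₁ g₂ : ℝ → ℝ³ → F}, ContDiffOn ℝ ∞ (uncurry g₁) (Icc 0 T₁ ×ˢ univ) →
      ContDiffOn ℝ ∞ (uncurry g₂) (Icc a b ×ˢ univ) →
      (∀ t, t < T₁ → g t = g₁ t) → (∀ t, a ≤ t → g t = g₂ t) →
      ContDiffOn ℝ ∞ (uncurry g) (Icc 0 b ×ˢ univ) := by
    intro F _ _ g g₁ g₂ hg₁ hg₂ he₁ he₂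
    refine contDiffOn_of_locally_contDiffOn fun z hz => ?_
    obtain ⟨t, x⟩ := z
    have ht : t ∈ Icc 0 b := hz.1
    by_cases htT : t < T₁
    · refine ⟨Iio T₁ ×ˢ univ, isOpen_Iio.prod isOpen_univ, ⟨htT, mem_univ _⟩, ?_⟩
      rw [prod_inter_prod, univ_inter, hI₁]
      refine (hg₁.mono (prod_mono inter_subset_left Subset.rfl)).congr fun z hz => ?_
      obtain ⟨τ, y⟩ := z
      have hτ : τ < T₁ := hz.1.2
      simp only [uncurry_apply_pair, he₁ τ hτ]
    · have hat : a < t := haT.trans_le (not_lt.1 htT)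
      refine ⟨Ioi a ×ˢ univ, isOpen_Ioi.prod isOpen_univ, ⟨hat, mem_univ _⟩, ?_⟩
      rw [prod_inter_prod, univ_inter]
      have hsub : Icc 0 b ∩ Ioi a ⊆ Icc a b := fun τ hτ => ⟨le_of_lt hτ.2, hτ.1.2⟩
      refine (hg₂.mono (prod_mono hsub Subset.rfl)).congr fun z hz => ?_
      obtain ⟨τ, y⟩ := z
      have hτ : a < τ := hz.1.2
      simp only [uncurry_apply_pair, he₂ τ hτ.le]
  have hsmw : IsSmoothSpaceTimeOn (Icc 0 b) w := hsmooth h₁.classical.smooth_velocity hsm₂u hw₁ hw₂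
  have hsmq : IsSmoothSpaceTimeOn (Icc 0 b) q := hsmooth h₁.classical.smooth_pressure hsm₂p hq₁ hq₂
  /- the one-sided time derivative of the glued velocity -/
  have hD₁ : ∀ t ∈ Icc 0 b, t < T₁ → ∀ x,
      timeDerivWithin (Icc 0 b) w t x = timeDerivWithin (Icc 0 T₁) u₁ t x := by
    intro t ht htT x
    have hev : (fun τ => w τ x) =ᶠ[𝓝 t] fun τ => u₁ τ x := by
      filter_upwards [Iio_mem_nhds htT] with τ hτ
      rw [hw₁ τ hτ]
    simp only [timeDerivWithin_apply]
    rw [(hev.filter_mono nhdsWithin_le_nhds).derivWithin_eq (by rw [hw₁ t htT]),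
      ← derivWithin_inter (Iio_mem_nhds htT), hI₁, derivWithin_inter (Iio_mem_nhds htT)]
  have hD₂ : ∀ t ∈ Icc 0 b, ¬ t < T₁ → ∀ x,
      timeDerivWithin (Icc 0 b) w t x = timeDerivWithin (Icc 0 T₂) u₂ (t - a) x := by
    intro t ht htT x
    have hat : a < t := haT.trans_le (not_lt.1 htT)
    have hev : (fun τ => w τ x) =ᶠ[𝓝 t] fun τ => u₂ (τ + -a) x := by
      filter_upwards [Ioi_mem_nhds hat] with τ hτ
      rw [hw₂ τ hτ.le, sub_eq_add_neg]
    simp only [timeDerivWithin_apply]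
    rw [(hev.filter_mono nhdsWithin_le_nhds).derivWithin_eq (by rw [hw₂ t hat.le, sub_eq_add_neg]),
      ← derivWithin_inter (Ioi_mem_nhds hat), hI₂, derivWithin_inter (Ioi_mem_nhds hat)]
    have h := timeDerivWithin_comp_add_right (Icc 0 T₂) u₂ (-a) t x
    simp only [timeDerivWithin_apply] at h
    rw [h, ← sub_eq_add_neg]
  /- membership bookkeeping -/
  have hmem₁ : ∀ {t : ℝ}, t ∈ Icc 0 b → t < T₁ → t ∈ Icc 0 T₁ := fun ht htT => ⟨ht.1, htT.le⟩
  have hmem₂ : ∀ {t : ℝ}, t ∈ Icc 0 b → ¬ t < T₁ → t - a ∈ Icc 0 T₂ := fun {t} ht htT =>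
    ⟨by linarith [not_lt.1 htT], by rw [hb] at ht; linarith [ht.2]⟩
  refine ⟨⟨hsmw, hsmq, ?_, ?_⟩, ?_, ?_, ?_, ?_, ?_⟩
  · -- momentum
    intro t ht x
    by_cases htT : t < T₁
    · rw [hD₁ t ht htT x, hw₁ t htT, hq₁ t htT]
      exact h₁.classical.momentum t (hmem₁ ht htT) x
    · rw [hD₂ t ht htT x, hw₂ t (haT.trans_le (not_lt.1 htT)).le,
        hq₂ t (haT.trans_le (not_lt.1 htT)).le]
      simpa using h₂.classical.momentum (t - a) (hmem₂ ht htT) x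
  · -- incompressibility
    intro t ht
    by_cases htT : t < T₁
    · rw [hw₁ t htT]; exact h₁.classical.divFree t (hmem₁ ht htT)
    · rw [hw₂ t (haT.trans_le (not_lt.1 htT)).le]
      exact h₂.classical.divFree (t - a) (hmem₂ ht htT)
  · -- datum
    rw [hw₁ 0 hT₁, h₁.initial]
  · -- Sobolev bounds of `w`
    intro n
    obtain ⟨C₁, hC₁⟩ := h₁.sobolev n
    obtain ⟨C₂, hC₂⟩ := h₂.sobolev n
    refine ⟨max C₁ C₂, fun t ht => ?_⟩
    by_cases htT : t < T₁
    · rw [hw₁ t htT]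
      exact (hC₁ t (hmem₁ ht htT)).trans (ENNReal.coe_le_coe.2 (le_max_left _ _))
    · rw [hw₂ t (haT.trans_le (not_lt.1 htT)).le]
      exact (hC₂ (t - a) (hmem₂ ht htT)).trans (ENNReal.coe_le_coe.2 (le_max_right _ _))
  · -- Sobolev bounds of `∂ₜw`
    intro n
    obtain ⟨C₁, hC₁⟩ := h₁.sobolev_dt n
    obtain ⟨C₂, hC₂⟩ := h₂.sobolev_dt n
    refine ⟨max C₁ C₂, fun t ht => ?_⟩
    by_cases htT : t < T₁
    · have heq : timeDerivWithin (Icc 0 b) w t = timeDerivWithin (Icc 0 T₁) u₁ t :=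
        funext fun x => hD₁ t ht htT x
      rw [heq]
      exact (hC₁ t (hmem₁ ht htT)).trans (ENNReal.coe_le_coe.2 (le_max_left _ _))
    · have heq : timeDerivWithin (Icc 0 b) w t = timeDerivWithin (Icc 0 T₂) u₂ (t - a) :=
        funext fun x => hD₂ t ht htT x
      rw [heq]
      exact (hC₂ (t - a) (hmem₂ ht htT)).trans (ENNReal.coe_le_coe.2 (le_max_right _ _))
  · -- Sobolev bounds of `q`
    intro n
    obtain ⟨C₁, hC₁⟩ := h₁.sobolev_p n
    obtain ⟨C₂, hC₂⟩ := h₂.sobolev_p n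
    refine ⟨max C₁ C₂, fun t ht => ?_⟩
    by_cases htT : t < T₁
    · rw [hq₁ t htT]
      exact (hC₁ t (hmem₁ ht htT)).trans (ENNReal.coe_le_coe.2 (le_max_left _ _))
    · rw [hq₂ t (haT.trans_le (not_lt.1 htT)).le]
      exact (hC₂ (t - a) (hmem₂ ht htT)).trans (ENNReal.coe_le_coe.2 (le_max_right _ _))
  · -- `w ∈ C([0, b]; L²)`: on `[0, m₀]` it is `u₁`, on `[a, b]` it is `u₂(· - a)`
    set m₀ : ℝ := (a + T₁) / 2 with hm₀
    have ham₀ : a < m₀ := by rw [hm₀]; linarith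
    have hm₀T : m₀ < T₁ := by rw [hm₀]; linarith
    have hK₁ : ContinuousInLpOn (Icc 0 m₀) 2 w :=
      (h₁.continuousL2.mono (Icc_subset_Icc_right hm₀T.le)).congr_eqOn fun t ht =>
        (hw₁ t (ht.2.trans_lt hm₀T)).symm
    have hK₂ : ContinuousInLpOn (Icc a b) 2 w := by
      have h := h₂.continuousL2.comp_add_right (-a)
      rw [hpre] at h
      exact h.congr_eqOn fun t ht => by rw [hw₂ t ht.1, sub_eq_add_neg]
    have hunion : Icc 0 m₀ ∪ Icc a b = Icc 0 b := by
      refine Subset.antisymm (union_subset (Icc_subset_Icc_right (by linarith))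
        (Icc_subset_Icc_left ha)) fun t ht => ?_
      rcases le_or_gt t m₀ with h | h
      · exact Or.inl ⟨ht.1, h⟩
      · exact Or.inr ⟨(ham₀.trans h).le, ht.2⟩
    rw [← hunion]
    exact hK₁.union_of_isClosed hK₂ isClosed_Icc isClosed_Icc

end IsTaoSolutionOn

end Literature.Analysis.FluidPDE

end
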